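import Literature.Analysis.ODE.KernelTwoPointBound
import Literature.Analysis.ODE.ConjugatePairWronskian
import HarnessLib

/-!
# Pairing of the Wronskian with two flux-carrying solutions WITHOUT a sign condition
# (superradiant regime), and the global two-wave representation over one of them

Topic `Literature/Analysis/ODE` (namespace `Literature.Analysis.ODE`), companion of
`KernelPairing.lean` / `KernelTwoPointBound.lean` (flux regime `ωσ > 0`) and of
`ConjugatePairWronskian.lean` (amplitudes over a conjugate pair on an interval). For two complex
solutions `u, v` of a REAL equation `y″ = −φ y` with conserved fluxes `Im(ū u′) ≡ −σ`,
`Im(v̄ v′) ≡ ω` and Wronskian `W = u v′ − v u′`, the identity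
`Im(conj(u v)·W) = ω|u|² + σ|v|²` controls `v` by `u` (and `u` by `v`) ONLY when `ωσ > 0`. In the
SUPERRADIANT regime `ωσ < 0` (the horizon- and infinity-normalised solutions of a radial wave
equation at a superradiant frequency) the same identity still gives a ONE-SIDED, sign-free control
with an additive flux term — the quantitative form of "reflection with gain is at most
`√(1 + |ω/σ|/|c₂|²)`":

* `abs_mul_norm_sq_le_of_fluxes` — `|σ|‖v‖² ≤ ‖u‖‖v‖‖W‖ + |ω|‖u‖²` (any signs of `σ, ω`);
* `abs_mul_norm_le_of_fluxes` / `abs_mul_norm_le_of_fluxes'` — solving the quadratic: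
  `|σ|‖v‖ ≤ ‖u‖·(‖W‖ + √(|ω||σ|))` and `|ω|‖u‖ ≤ ‖v‖·(‖W‖ + √(|ω||σ|))`;
* `kernel_le_of_envelope_left_of_fluxes` (`…_right_…`) — two points `x, x′` on the side where ONE
  solution is enveloped (`‖u x‖, ‖u x′‖ ≤ P`): `‖u x‖‖v x′‖ ≤ (P²/|σ|)(‖W(x′)‖ + √(|ω||σ|))`; with a
  Wronskian floor `0 < W₀ ≤ ‖W‖` this is `≤ (P²/|σ|)(1 + √(|ω||σ|)/W₀)·‖W‖`
  (`kernel_le_of_envelope_left_of_floor`, `…_right_of_floor`) — the "cap × cap" and "far × far"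
  pairs of the two-point Green kernel across a superradiant barrier, the floor being supplied by
  the tunnelling estimate inside the barrier (not here);
* `ConjugatePair.global_decomp`, `ConjugatePair.global_norm_wronskian`,
  `ConjugatePair.global_flux_eq`, `ConjugatePair.norm_sq_amplitude_eq`,
  `ConjugatePair.norm_le_amplitudes_mul` — for GLOBAL solutions on `ℝ` with `u` carrying flux:
  the exact two-wave representation `v = C₁ u + C₂ ū` on all of `ℝ` with CONSTANT amplitudes,
  `‖W‖ = 2|Im(ū u′)|·‖C₂‖`, `Im(v̄ v′) = (‖C₁‖² − ‖C₂‖²)·Im(ū u′)` (so `‖C₁‖² − ‖C₂‖² = −ω/σ`: gain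
  iff `ωσ < 0`), and `‖v x‖ ≤ (‖C₁‖ + ‖C₂‖)‖u x‖` — the interval statements of
  `ConjugatePairWronskian.lean` globalised through the constancy of the three Wronskians
  (`wronskian_eq_of_global`).

Everything is one-point algebra plus constancy of Wronskians/fluxes; all proved. Deliberately NOT
here: any lower bound on `‖W‖` (quantitative mode stability), any equation-specific input.

## References
* W. H. Press, S. A. Teukolsky, Nature 238 (1972) 211 (superradiant amplification
  `|reflection|² = 1 − (transmitted flux)/(incident flux) > 1`). Key `PressTeukolsky1972`.
* M. Dafermos, I. Rodnianski, Y. Shlapentokh-Rothman, arXiv:1402.7034, §7.2 (fluxes of the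
  normalised pair, the Wronskian identity); R. Teixeira da Costa, CMP 378 (2020), Prop. 2.20.
* P. Hartman, *Ordinary Differential Equations* (SIAM Classics 38, 2002), Ch. XI §2. Key
  `Hartman2002`. The algebra is folklore.
-/

noncomputable section

open Set
open scoped ComplexConjugate

namespace Literature.Analysis.ODE

section OnePoint

/-! ### Sign-free pairing at one point -/

variable {u u' v v' : ℂ} {σ ω : ℝ}

/-- **Sign-free pairing.** If `Im(ū u′) = −σ` and `Im(v̄ v′) = ω` (any signs), then
`|σ|·‖v‖² ≤ ‖u‖‖v‖·‖u v′ − v u′‖ + |ω|·‖u‖²`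
(`|ω‖u‖² + σ‖v‖²| = |Im(conj(uv)·W)| ≤ ‖u‖‖v‖‖W‖`). [folklore] -/
theorem abs_mul_norm_sq_le_of_fluxes (hu : (conj u * u').im = -σ) (hv : (conj v * v').im = ω) :
    |σ| * ‖v‖ ^ 2 ≤ ‖u‖ * ‖v‖ * ‖u * v' - v * u'‖ + |ω| * ‖u‖ ^ 2 := by
  have hid := Literature.Geometry.Lorentzian.Kerr.Costa2019.im_conj_mul_det u u' v v'
  rw [hu, hv] at hid
  have hle : |(conj (u * v) * (u * v' - v * u')).im| ≤ ‖conj (u * v) * (u * v' - v * u')‖ :=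
    Complex.abs_im_le_norm _
  rw [hid, norm_mul, Complex.norm_conj, norm_mul] at hle
  obtain ⟨h1, h2⟩ := abs_le.1 hle
  have hω1 : ω * ‖u‖ ^ 2 ≤ |ω| * ‖u‖ ^ 2 := mul_le_mul_of_nonneg_right (le_abs_self ω) (sq_nonneg _)
  have hω2 : -ω * ‖u‖ ^ 2 ≤ |ω| * ‖u‖ ^ 2 :=
    mul_le_mul_of_nonneg_right (neg_le_abs ω) (sq_nonneg _)
  rcases le_or_gt 0 σ with hσ | hσ
  · rw [abs_of_nonneg hσ]
    nlinarith [h1, h2, hω1, hω2]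
  · rw [abs_of_neg hσ]
    nlinarith [h1, h2, hω1, hω2]

/-- **Sign-free pairing, solved**: `|σ|·‖v‖ ≤ ‖u‖·(‖u v′ − v u′‖ + √(|ω|·|σ|))` for
`Im(ū u′) = −σ`, `Im(v̄ v′) = ω` of any signs (the positive root of the quadratic inequality
`abs_mul_norm_sq_le_of_fluxes`, using `√(W² + 4|ωσ|) ≤ W + 2√|ωσ|`). In the flux regime the
additive term is superfluous (`mul_norm_le_of_pairing_right`); in the superradiant regime it is the
gain of the reflection. [folklore] -/
theorem abs_mul_norm_le_of_fluxes (hu : (conj u * u').im = -σ) (hv : (conj v * v').im = ω) :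
    |σ| * ‖v‖ ≤ ‖u‖ * (‖u * v' - v * u'‖ + Real.sqrt (|ω| * |σ|)) := by
  have hsq := abs_mul_norm_sq_le_of_fluxes hu hv
  set U := ‖u‖ with hU
  set V := ‖v‖ with hV
  set Wn := ‖u * v' - v * u'‖ with hWn
  set s := Real.sqrt (|ω| * |σ|) with hs
  have hU0 : 0 ≤ U := norm_nonneg _
  have hV0 : 0 ≤ V := norm_nonneg _
  have hW0 : 0 ≤ Wn := norm_nonneg _
  have hs0 : 0 ≤ s := Real.sqrt_nonneg _
  have hs2 : s ^ 2 = |ω| * |σ| := Real.sq_sqrt (by positivity)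
  by_contra h
  push Not at h
  -- `h : U * (Wn + s) < |σ| * V`
  have hσ0 : 0 < |σ| := by
    rcases (abs_nonneg σ).eq_or_lt with h0 | h0
    · rw [← h0, zero_mul] at h
      exact absurd h (not_lt.2 (by positivity))
    · exact h0
  have hV1 : 0 < V := by
    rcases hV0.eq_or_lt with h0 | h0
    · rw [← h0, mul_zero] at h
      exact absurd h (not_lt.2 (by positivity))
    · exact h0
  have h1 : U * s ≤ |σ| * V := by nlinarith [mul_nonneg hU0 hW0]
  -- `|ω| U ≤ V s` (multiply `h1` by `s` and divide by `|σ|`)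
  have h2 : |ω| * U ≤ V * s := by
    have h3 : U * s * s ≤ |σ| * V * s := mul_le_mul_of_nonneg_right h1 hs0
    have h4 : U * s * s = |σ| * (|ω| * U) := by rw [mul_assoc, ← sq, hs2]; ring
    rw [h4, show |σ| * V * s = |σ| * (V * s) by ring] at h3
    exact le_of_mul_le_mul_left h3 hσ0
  -- hence `|σ| V² > U V Wn + |ω| U²`, contradicting the pairing
  have h5 : U * V * Wn + |ω| * U ^ 2 < |σ| * V ^ 2 := by
    have e1 : |σ| * V ^ 2 = V * (|σ| * V) := by ring
    have e2 : V * (U * (Wn + s)) = U * V * Wn + U * (V * s) := by ring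
    have h6 : V * (U * (Wn + s)) < V * (|σ| * V) := mul_lt_mul_of_pos_left h hV1
    rw [e1, ← sub_pos]
    rw [e2, ← sub_pos] at h6
    nlinarith [mul_le_mul_of_nonneg_left h2 hU0]
  exact absurd hsq (not_le.2 h5)

/-- **Sign-free pairing, solved for the other factor**: `|ω|·‖u‖ ≤ ‖v‖·(‖u v′ − v u′‖ + √(|ω|·|σ|))`
(`abs_mul_norm_le_of_fluxes` for the swapped pair). [folklore] -/
theorem abs_mul_norm_le_of_fluxes' (hu : (conj u * u').im = -σ) (hv : (conj v * v').im = ω) :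
    |ω| * ‖u‖ ≤ ‖v‖ * (‖u * v' - v * u'‖ + Real.sqrt (|ω| * |σ|)) := by
  have hv' : (conj v * v').im = -(-ω) := by rw [hv, neg_neg]
  have key := abs_mul_norm_le_of_fluxes (σ := -ω) (ω := -σ) hv' hu
  rwa [abs_neg, abs_neg, norm_sub_rev, mul_comm |σ| |ω|] at key

end OnePoint

section TwoPoint

/-! ### Two points on the side where one solution is enveloped -/

variable {u u' v v' : ℝ → ℂ} {σ ω : ℝ}

/-- **Two-point kernel from an envelope of `u` at both points** (e.g. both points in the cap
before a barrier, `u` the horizon-type solution). If `Im(ū u′)(x′) = −σ ≠ 0`, `Im(v̄ v′)(x′) = ω`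
and `‖u x‖, ‖u x′‖ ≤ P`, then `‖u x‖‖v x′‖ ≤ (P²/|σ|)·(‖W(x′)‖ + √(|ω||σ|))`. [folklore] -/
theorem kernel_le_of_envelope_left_of_fluxes {x x' P : ℝ} (hu : (conj (u x') * u' x').im = -σ)
    (hv : (conj (v x') * v' x').im = ω) (hσ : σ ≠ 0) (hPx : ‖u x‖ ≤ P) (hPx' : ‖u x'‖ ≤ P) :
    ‖u x‖ * ‖v x'‖ ≤
      P ^ 2 / |σ| * (‖u x' * v' x' - v x' * u' x'‖ + Real.sqrt (|ω| * |σ|)) := by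
  have hσ' : 0 < |σ| := abs_pos.2 hσ
  have hP0 : 0 ≤ P := (norm_nonneg _).trans hPx
  have hT0 : 0 ≤ ‖u x' * v' x' - v x' * u' x'‖ + Real.sqrt (|ω| * |σ|) := by positivity
  have h1 := abs_mul_norm_le_of_fluxes hu hv
  have h2 : |σ| * (‖u x‖ * ‖v x'‖) ≤
      P ^ 2 * (‖u x' * v' x' - v x' * u' x'‖ + Real.sqrt (|ω| * |σ|)) := by
    calc |σ| * (‖u x‖ * ‖v x'‖) = ‖u x‖ * (|σ| * ‖v x'‖) := by ring
      _ ≤ P * (‖u x'‖ * (‖u x' * v' x' - v x' * u' x'‖ + Real.sqrt (|ω| * |σ|))) :=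
          mul_le_mul hPx h1 (by positivity) hP0
      _ ≤ P * (P * (‖u x' * v' x' - v x' * u' x'‖ + Real.sqrt (|ω| * |σ|))) :=
          mul_le_mul_of_nonneg_left (mul_le_mul_of_nonneg_right hPx' hT0) hP0
      _ = P ^ 2 * (‖u x' * v' x' - v x' * u' x'‖ + Real.sqrt (|ω| * |σ|)) := by ring
  rw [div_mul_eq_mul_div, le_div_iff₀ hσ']
  linarith

/-- **Two-point kernel from an envelope of `v` at both points** (e.g. both points beyond the
barrier, `v` the infinity-type solution). If `Im(ū u′)(x) = −σ`, `Im(v̄ v′)(x) = ω ≠ 0` and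
`‖v x‖, ‖v x′‖ ≤ P`, then `‖u x‖‖v x′‖ ≤ (P²/|ω|)·(‖W(x)‖ + √(|ω||σ|))`. [folklore] -/
theorem kernel_le_of_envelope_right_of_fluxes {x x' P : ℝ} (hu : (conj (u x) * u' x).im = -σ)
    (hv : (conj (v x) * v' x).im = ω) (hω : ω ≠ 0) (hPx : ‖v x‖ ≤ P) (hPx' : ‖v x'‖ ≤ P) :
    ‖u x‖ * ‖v x'‖ ≤
      P ^ 2 / |ω| * (‖u x * v' x - v x * u' x‖ + Real.sqrt (|ω| * |σ|)) := by
  have hω' : 0 < |ω| := abs_pos.2 hω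
  have hP0 : 0 ≤ P := (norm_nonneg _).trans hPx
  have hT0 : 0 ≤ ‖u x * v' x - v x * u' x‖ + Real.sqrt (|ω| * |σ|) := by positivity
  have h1 := abs_mul_norm_le_of_fluxes' hu hv
  have h2 : |ω| * (‖u x‖ * ‖v x'‖) ≤
      P ^ 2 * (‖u x * v' x - v x * u' x‖ + Real.sqrt (|ω| * |σ|)) := by
    calc |ω| * (‖u x‖ * ‖v x'‖) = (|ω| * ‖u x‖) * ‖v x'‖ := by ring
      _ ≤ (‖v x‖ * (‖u x * v' x - v x * u' x‖ + Real.sqrt (|ω| * |σ|))) * P :=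
          mul_le_mul h1 hPx' (norm_nonneg _) (by positivity)
      _ ≤ (P * (‖u x * v' x - v x * u' x‖ + Real.sqrt (|ω| * |σ|))) * P :=
          mul_le_mul_of_nonneg_right (mul_le_mul_of_nonneg_right hPx hT0) hP0
      _ = P ^ 2 * (‖u x * v' x - v x * u' x‖ + Real.sqrt (|ω| * |σ|)) := by ring
  rw [div_mul_eq_mul_div, le_div_iff₀ hω']
  linarith

/-- With a Wronskian floor: `T + √(|ω||σ|) ≤ (1 + √(|ω||σ|)/W₀)·T` whenever `0 < W₀ ≤ T`.
[folklore] -/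
theorem add_sqrt_le_mul_of_floor {T W₀ : ℝ} (hW₀ : 0 < W₀) (hT : W₀ ≤ T) (σ ω : ℝ) :
    T + Real.sqrt (|ω| * |σ|) ≤ (1 + Real.sqrt (|ω| * |σ|) / W₀) * T := by
  have hs0 : 0 ≤ Real.sqrt (|ω| * |σ|) := Real.sqrt_nonneg _
  have h1 : Real.sqrt (|ω| * |σ|) ≤ Real.sqrt (|ω| * |σ|) / W₀ * T := by
    rw [div_mul_eq_mul_div, le_div_iff₀ hW₀]
    exact mul_le_mul_of_nonneg_left hT hs0
  linarith

/-- **Cap × cap pairs with a Wronskian floor.** Under the hypotheses of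
`kernel_le_of_envelope_left_of_fluxes`, if moreover `0 < W₀ ≤ ‖W(x′)‖`, then
`‖u x‖‖v x′‖ ≤ (P²/|σ|)(1 + √(|ω||σ|)/W₀)·‖W(x′)‖`. [folklore] -/
theorem kernel_le_of_envelope_left_of_floor {x x' P W₀ : ℝ} (hu : (conj (u x') * u' x').im = -σ)
    (hv : (conj (v x') * v' x').im = ω) (hσ : σ ≠ 0) (hPx : ‖u x‖ ≤ P) (hPx' : ‖u x'‖ ≤ P)
    (hW₀ : 0 < W₀) (hfloor : W₀ ≤ ‖u x' * v' x' - v x' * u' x'‖) :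
    ‖u x‖ * ‖v x'‖ ≤
      P ^ 2 / |σ| * (1 + Real.sqrt (|ω| * |σ|) / W₀) * ‖u x' * v' x' - v x' * u' x'‖ := by
  have h1 := kernel_le_of_envelope_left_of_fluxes hu hv hσ hPx hPx'
  have h2 := add_sqrt_le_mul_of_floor hW₀ hfloor σ ω
  have h0 : 0 ≤ P ^ 2 / |σ| := by positivity
  calc ‖u x‖ * ‖v x'‖ ≤ _ := h1
    _ ≤ P ^ 2 / |σ| * ((1 + Real.sqrt (|ω| * |σ|) / W₀) * ‖u x' * v' x' - v x' * u' x'‖) :=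
        mul_le_mul_of_nonneg_left h2 h0
    _ = _ := by ring

/-- **Far × far pairs with a Wronskian floor.** Under the hypotheses of
`kernel_le_of_envelope_right_of_fluxes`, if moreover `0 < W₀ ≤ ‖W(x)‖`, then
`‖u x‖‖v x′‖ ≤ (P²/|ω|)(1 + √(|ω||σ|)/W₀)·‖W(x)‖`. [folklore] -/
theorem kernel_le_of_envelope_right_of_floor {x x' P W₀ : ℝ} (hu : (conj (u x) * u' x).im = -σ)
    (hv : (conj (v x) * v' x).im = ω) (hω : ω ≠ 0) (hPx : ‖v x‖ ≤ P) (hPx' : ‖v x'‖ ≤ P)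
    (hW₀ : 0 < W₀) (hfloor : W₀ ≤ ‖u x * v' x - v x * u' x‖) :
    ‖u x‖ * ‖v x'‖ ≤
      P ^ 2 / |ω| * (1 + Real.sqrt (|ω| * |σ|) / W₀) * ‖u x * v' x - v x * u' x‖ := by
  have h1 := kernel_le_of_envelope_right_of_fluxes hu hv hω hPx hPx'
  have h2 := add_sqrt_le_mul_of_floor hW₀ hfloor σ ω
  have h0 : 0 ≤ P ^ 2 / |ω| := by positivity
  calc ‖u x‖ * ‖v x'‖ ≤ _ := h1
    _ ≤ P ^ 2 / |ω| * ((1 + Real.sqrt (|ω| * |σ|) / W₀) * ‖u x * v' x - v x * u' x‖) :=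
        mul_le_mul_of_nonneg_left h2 h0
    _ = _ := by ring

end TwoPoint

section Global

/-! ### Global solutions: constancy of fluxes and the two-wave representation over `u, ū` -/

variable {u u' v v' : ℝ → ℂ} {φ : ℝ → ℝ}

/-- A global solution of `y″ = −φ y`, restricted to `[α, β]`, in the `q = −φ` form consumed by the
interval lemmas. [folklore] -/
theorem sol_Icc_of_global (hu : ∀ x, HasDerivAt u (u' x) x ∧ HasDerivAt u' (-((φ x : ℂ) * u x)) x)
    (α β : ℝ) :
    ∀ x ∈ Icc α β, HasDerivAt u (u' x) x ∧ HasDerivAt u' (((fun y ↦ -φ y) x : ℂ) * u x) x :=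
  fun x _ ↦ ⟨(hu x).1, by simpa only [Complex.ofReal_neg, neg_mul] using (hu x).2⟩

/-- **The conjugate of a global solution of a real equation is a global solution.** [folklore] -/
theorem conj_sol_of_global
    (hu : ∀ x, HasDerivAt u (u' x) x ∧ HasDerivAt u' (-((φ x : ℂ) * u x)) x) :
    ∀ x, HasDerivAt (fun t ↦ conj (u t)) (conj (u' x)) x ∧
      HasDerivAt (fun t ↦ conj (u' t)) (-((φ x : ℂ) * conj (u x))) x := by
  intro x
  have h1 : HasDerivAt (fun t ↦ conj (u t)) (conj (u' x)) x := (hu x).1.star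
  have h2 : HasDerivAt (fun t ↦ conj (u' t)) (conj (-((φ x : ℂ) * u x))) x := (hu x).2.star
  refine ⟨h1, h2.congr_deriv ?_⟩
  rw [map_neg, map_mul, Complex.conj_ofReal]

/-- **The flux of a global solution is the same at any two points.** [folklore] -/
theorem flux_eq_of_global
    (hu : ∀ x, HasDerivAt u (u' x) x ∧ HasDerivAt u' (-((φ x : ℂ) * u x)) x) (s t : ℝ) :
    (conj (u s) * u' s).im = (conj (u t) * u' t).im := by
  rcases le_total s t with h | h
  · exact (flux_const (sol_Icc_of_global hu s t) (right_mem_Icc.2 h)).symm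
  · exact flux_const (sol_Icc_of_global hu t s) (right_mem_Icc.2 h)

/-- **Global two-wave representation over `u, ū`.** Let `u, v` be global solutions of the real
equation `y″ = −φ y` and let `u` carry flux at `x₀`, `Im(ū(x₀) u′(x₀)) ≠ 0`. Then for EVERY `x`,
`v x = C₁·u x + C₂·conj(u x)` and `v′ x = C₁·u′ x + C₂·conj(u′ x)` with the constant amplitudes
`C₁ = (v ū′ − v′ ū)(x₀)/(u ū′ − u′ ū)(x₀)`, `C₂ = (v′ u − v u′)(x₀)/(u ū′ − u′ ū)(x₀)`
(`ConjugatePair.decomp` on `[min x x₀, max x x₀]`, the amplitudes moved to `x₀` by the constancy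
of the three Wronskians). [folklore] -/
theorem ConjugatePair.global_decomp
    (hu : ∀ x, HasDerivAt u (u' x) x ∧ HasDerivAt u' (-((φ x : ℂ) * u x)) x)
    (hv : ∀ x, HasDerivAt v (v' x) x ∧ HasDerivAt v' (-((φ x : ℂ) * v x)) x)
    {x₀ : ℝ} (hf : (conj (u x₀) * u' x₀).im ≠ 0) (x : ℝ) :
    v x = (v x₀ * conj (u' x₀) - v' x₀ * conj (u x₀)) /
            (u x₀ * conj (u' x₀) - u' x₀ * conj (u x₀)) * u x +
          (v' x₀ * u x₀ - v x₀ * u' x₀) / (u x₀ * conj (u' x₀) - u' x₀ * conj (u x₀)) *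
            conj (u x) ∧
      v' x = (v x₀ * conj (u' x₀) - v' x₀ * conj (u x₀)) /
            (u x₀ * conj (u' x₀) - u' x₀ * conj (u x₀)) * u' x +
          (v' x₀ * u x₀ - v x₀ * u' x₀) / (u x₀ * conj (u' x₀) - u' x₀ * conj (u x₀)) *
            conj (u' x) := by
  have hū := conj_sol_of_global hu
  rcases le_total x₀ x with h | h
  · exact ConjugatePair.decomp (q := fun y ↦ -φ y) (sol_Icc_of_global hv x₀ x)
      (sol_Icc_of_global hu x₀ x) hf (right_mem_Icc.2 h)
  · -- base point `x`, then move the amplitudes from `x` to `x₀`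
    have hf' : (conj (u x) * u' x).im ≠ 0 := by rwa [flux_eq_of_global hu x x₀]
    have key := ConjugatePair.decomp (q := fun y ↦ -φ y) (sol_Icc_of_global hv x x₀)
      (sol_Icc_of_global hu x x₀) hf' (left_mem_Icc.2 h)
    -- the three Wronskians `W(v, ū)`, `W(u, v)`, `W(u, ū)` at `x` and at `x₀`
    have h1 : v x * conj (u' x) - v' x * conj (u x) = v x₀ * conj (u' x₀) - v' x₀ * conj (u x₀) := by
      have e := wronskian_eq_of_global hv hū x x₀
      linear_combination e
    have h2 : v' x * u x - v x * u' x = v' x₀ * u x₀ - v x₀ * u' x₀ := by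
      have e := wronskian_eq_of_global hu hv x x₀
      linear_combination e
    have h3 : u x * conj (u' x) - u' x * conj (u x) = u x₀ * conj (u' x₀) - u' x₀ * conj (u x₀) := by
      have e := wronskian_eq_of_global hu hū x x₀
      linear_combination e
    rw [h1, h2, h3] at key
    exact key

/-- **`‖W(u, v)‖ = 2|Im(ū u′)|·‖C₂‖` globally.** Under the hypotheses of
`ConjugatePair.global_decomp`, at every `x`:
`‖u x·v′ x − v x·u′ x‖ = ‖C₂‖·(2|Im(ū(x₀) u′(x₀))|)` — the Wronskian only sees the `ū`-amplitude
of `v`. [folklore] -/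
theorem ConjugatePair.global_norm_wronskian
    (hu : ∀ x, HasDerivAt u (u' x) x ∧ HasDerivAt u' (-((φ x : ℂ) * u x)) x)
    (hv : ∀ x, HasDerivAt v (v' x) x ∧ HasDerivAt v' (-((φ x : ℂ) * v x)) x)
    {x₀ : ℝ} (hf : (conj (u x₀) * u' x₀).im ≠ 0) (x : ℝ) :
    ‖u x * v' x - v x * u' x‖ =
      ‖(v' x₀ * u x₀ - v x₀ * u' x₀) / (u x₀ * conj (u' x₀) - u' x₀ * conj (u x₀))‖ *
        (2 * |(conj (u x₀) * u' x₀).im|) := by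
  obtain ⟨h0, h1⟩ := ConjugatePair.global_decomp hu hv hf x
  set C₁ := (v x₀ * conj (u' x₀) - v' x₀ * conj (u x₀)) /
    (u x₀ * conj (u' x₀) - u' x₀ * conj (u x₀)) with hC₁
  set C₂ := (v' x₀ * u x₀ - v x₀ * u' x₀) / (u x₀ * conj (u' x₀) - u' x₀ * conj (u x₀)) with hC₂
  have e : u x * v' x - v x * u' x = C₂ * (u x * conj (u' x) - u' x * conj (u x)) := by
    rw [h0, h1]; ring
  rw [e, norm_mul, ConjugatePair.norm_wronskian_self_conj, flux_eq_of_global hu x x₀]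

/-- **Flux of `v` through its amplitudes over `u, ū`**: at every `x`,
`Im(v̄(x) v′(x)) = (‖C₁‖² − ‖C₂‖²)·Im(ū(x₀) u′(x₀))`. For the normalised pair of a radial wave
equation (`Im(ū u′) = −σ`, `Im(v̄ v′) = ω`) this reads `‖C₁‖² − ‖C₂‖² = −ω/σ`: GAIN (`‖C₁‖ > ‖C₂‖`)
exactly in the superradiant regime `ωσ < 0`. [cite: PressTeukolsky1972, eq. (2)] -/
theorem ConjugatePair.global_flux_eq
    (hu : ∀ x, HasDerivAt u (u' x) x ∧ HasDerivAt u' (-((φ x : ℂ) * u x)) x)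
    (hv : ∀ x, HasDerivAt v (v' x) x ∧ HasDerivAt v' (-((φ x : ℂ) * v x)) x)
    {x₀ : ℝ} (hf : (conj (u x₀) * u' x₀).im ≠ 0) (x : ℝ) :
    (conj (v x) * v' x).im =
      (‖(v x₀ * conj (u' x₀) - v' x₀ * conj (u x₀)) /
            (u x₀ * conj (u' x₀) - u' x₀ * conj (u x₀))‖ ^ 2 -
        ‖(v' x₀ * u x₀ - v x₀ * u' x₀) / (u x₀ * conj (u' x₀) - u' x₀ * conj (u x₀))‖ ^ 2) *
      (conj (u x₀) * u' x₀).im := by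
  obtain ⟨h0, h1⟩ := ConjugatePair.global_decomp hu hv hf x
  rw [h0, h1, ConjugatePair.flux_decomp, flux_eq_of_global hu x x₀]

/-- **The amplitudes from the two constant fluxes.** If `Im(ū u′) ≡ F_u ≠ 0` and
`Im(v̄ v′) ≡ F_v`, then `‖C₁‖² = ‖C₂‖² + F_v/F_u` and
`‖u x·v′ x − v x·u′ x‖ = 2|F_u|·‖C₂‖` at every `x`. [folklore] -/
theorem ConjugatePair.norm_sq_amplitude_eq
    (hu : ∀ x, HasDerivAt u (u' x) x ∧ HasDerivAt u' (-((φ x : ℂ) * u x)) x)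
    (hv : ∀ x, HasDerivAt v (v' x) x ∧ HasDerivAt v' (-((φ x : ℂ) * v x)) x)
    {Fu Fv : ℝ} (hfu : ∀ s, (conj (u s) * u' s).im = Fu) (hfv : ∀ s, (conj (v s) * v' s).im = Fv)
    (hFu : Fu ≠ 0) (x₀ x : ℝ) :
    ‖(v x₀ * conj (u' x₀) - v' x₀ * conj (u x₀)) /
          (u x₀ * conj (u' x₀) - u' x₀ * conj (u x₀))‖ ^ 2 =
        ‖(v' x₀ * u x₀ - v x₀ * u' x₀) / (u x₀ * conj (u' x₀) - u' x₀ * conj (u x₀))‖ ^ 2 +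
          Fv / Fu ∧
      ‖u x * v' x - v x * u' x‖ =
        2 * |Fu| *
          ‖(v' x₀ * u x₀ - v x₀ * u' x₀) / (u x₀ * conj (u' x₀) - u' x₀ * conj (u x₀))‖ := by
  have hf : (conj (u x₀) * u' x₀).im ≠ 0 := by rw [hfu x₀]; exact hFu
  set C₁ := (v x₀ * conj (u' x₀) - v' x₀ * conj (u x₀)) /
    (u x₀ * conj (u' x₀) - u' x₀ * conj (u x₀)) with hC₁
  set C₂ := (v' x₀ * u x₀ - v x₀ * u' x₀) / (u x₀ * conj (u' x₀) - u' x₀ * conj (u x₀)) with hC₂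
  constructor
  · have h := ConjugatePair.global_flux_eq hu hv hf x₀
    rw [hfv x₀, hfu x₀] at h
    rw [h, mul_div_cancel_right₀ _ hFu]
    ring
  · rw [ConjugatePair.global_norm_wronskian hu hv hf x, hfu x₀]; ring

/-- **`‖v x‖ ≤ (‖C₁‖ + ‖C₂‖)·‖u x‖`** at every `x`, and the amplitude bound
`‖C₁‖ ≤ ‖C₂‖ + √(|F_v|/|F_u|)` (from `‖C₁‖² = ‖C₂‖² + F_v/F_u`). [folklore] -/
theorem ConjugatePair.norm_le_amplitudes_mul
    (hu : ∀ x, HasDerivAt u (u' x) x ∧ HasDerivAt u' (-((φ x : ℂ) * u x)) x)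
    (hv : ∀ x, HasDerivAt v (v' x) x ∧ HasDerivAt v' (-((φ x : ℂ) * v x)) x)
    {Fu Fv : ℝ} (hfu : ∀ s, (conj (u s) * u' s).im = Fu) (hfv : ∀ s, (conj (v s) * v' s).im = Fv)
    (hFu : Fu ≠ 0) (x₀ x : ℝ) :
    ‖v x‖ ≤
      (‖(v x₀ * conj (u' x₀) - v' x₀ * conj (u x₀)) /
            (u x₀ * conj (u' x₀) - u' x₀ * conj (u x₀))‖ +
        ‖(v' x₀ * u x₀ - v x₀ * u' x₀) / (u x₀ * conj (u' x₀) - u' x₀ * conj (u x₀))‖) *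
        ‖u x‖ ∧
      ‖(v x₀ * conj (u' x₀) - v' x₀ * conj (u x₀)) /
          (u x₀ * conj (u' x₀) - u' x₀ * conj (u x₀))‖ ≤
        ‖(v' x₀ * u x₀ - v x₀ * u' x₀) / (u x₀ * conj (u' x₀) - u' x₀ * conj (u x₀))‖ +
          Real.sqrt (|Fv| / |Fu|) := by
  have hf : (conj (u x₀) * u' x₀).im ≠ 0 := by rw [hfu x₀]; exact hFu
  set C₁ := (v x₀ * conj (u' x₀) - v' x₀ * conj (u x₀)) /
    (u x₀ * conj (u' x₀) - u' x₀ * conj (u x₀)) with hC₁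
  set C₂ := (v' x₀ * u x₀ - v x₀ * u' x₀) / (u x₀ * conj (u' x₀) - u' x₀ * conj (u x₀)) with hC₂
  constructor
  · obtain ⟨h0, -⟩ := ConjugatePair.global_decomp hu hv hf x
    rw [h0]
    calc ‖C₁ * u x + C₂ * conj (u x)‖ ≤ ‖C₁ * u x‖ + ‖C₂ * conj (u x)‖ := norm_add_le _ _
      _ = (‖C₁‖ + ‖C₂‖) * ‖u x‖ := by rw [norm_mul, norm_mul, Complex.norm_conj]; ring
  · obtain ⟨hsq, -⟩ := ConjugatePair.norm_sq_amplitude_eq hu hv hfu hfv hFu x₀ x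
    have hr0 : 0 ≤ |Fv| / |Fu| := by positivity
    have h1 : ‖C₁‖ ^ 2 ≤ (‖C₂‖ + Real.sqrt (|Fv| / |Fu|)) ^ 2 := by
      have h2 : Fv / Fu ≤ |Fv| / |Fu| := by rw [← abs_div]; exact le_abs_self _
      have h3 : Real.sqrt (|Fv| / |Fu|) ^ 2 = |Fv| / |Fu| := Real.sq_sqrt hr0
      nlinarith [hsq, h2, h3, norm_nonneg C₂, Real.sqrt_nonneg (|Fv| / |Fu|)]
    exact le_of_pow_le_pow_left₀ two_ne_zero (by positivity) h1

end Global

end Literature.Analysis.ODE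

end
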